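import Literature.IUT.HodgeTheaters.PMBaseProp65Proofs

/-!
# Proofs over [IUTchI] Prop 6.5 (ii), second sentence: `†ξ^{Θ±}_{v_t,w_t} = †ξ^{Θell}_{v_t,w_t}`

Mochizuki, *Inter-universal Teichmüller theory I*, §6, Proposition 6.5 (ii) p. 164, kurims manuscript
(May 2020). PROOF-ONLY companion (theorems, no definitions) to abc-iut-L5-t4's `PMBaseBridgeProps.lean`,
by the L5 discharge seat abc-iut-L5-t13.

**Prop 6.5 (ii), second sentence (the EQUALITY) — PROVED UNCONDITIONALLY**
(`DThetaPMEllHT.xiPMEqXiEll`): the named statement `XiPMEqXiEll` for every `𝒟-Θ^{±ell}`-Hodge theater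
over every base kit. Mechanism: the four `ζ`'s are unique (Prop 6.5 (i)/(ii) first sentences:
`DThetaEllBridge.zeta_eq_zetaCandidate`, `DThetaPMBridge.zeta_eq`); in the joint model coordinates
`(ι, α, β, γ)` of the Hodge theater, `†ζ^{Θell}_{v_t} = Γ ∘ T_{ι⁻¹t} ∘ L_v ∘ LabCusp^±(α_{t,v})⁻¹` and
`†ζ^{Θ±}_{v_t} = LabCusp^±(β_v) ∘ LabCusp^±(α_{t,v})⁻¹`, so BOTH `†ξ^{Θ±}_{v_t,w_t}` and `†ξ^{Θell}_{v_t,w_t}`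
equal `LabCusp^±(α_{t,w}) ∘ L_w⁻¹ ∘ L_v ∘ LabCusp^±(α_{t,v})⁻¹` — the `β`'s, `Γ`'s and translations cancel
formally. (The synchronisation law `Ex63.PhiEllSync` is NOT needed for the equality; it is needed only
for the group-compatibility clause `XiGroupCompat`, cf. `PMBaseDischarge`.)
Record only; [claim: Mochizuki2012, status: disputed]; nothing here takes a side on any disputed step.
-/

namespace Literature.IUT.HodgeTheaters

open CategoryTheory

universe u

namespace PMBaseKit

variable {l : ℕ} {K : PMBaseKit.{u} l}

namespace DThetaPMEllHT

/-- **[IUTchI] Prop 6.5 (ii), second sentence — PROVED**: `†ξ^{Θ±}_{v_t,w_t} = †ξ^{Θell}_{v_t,w_t}` for every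
`𝒟-Θ^{±ell}`-Hodge theater (the named statement `XiPMEqXiEll`), unconditionally over the base interface.
[claim: Mochizuki2012, status: disputed] -/
theorem xiPMEqXiEll (H : K.DThetaPMEllHT) : H.XiPMEqXiEll := by
  intro t v w ζPv0 ζPw0 ζPvt ζPwt ζEv0 ζEw0 ζEvt ζEwt hPv0 hPw0 hPvt hPwt hEv0 hEw0 hEvt hEwt
  obtain ⟨ι, hι, α, β, γ, hPM, hEll⟩ := H.exists_model
  -- transported coordinates at arbitrary indices
  let αT : ∀ s : H.T, (DStrip.model K).Iso (H.capsule s) := fun s u =>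
    α (ι.symm s) u ≪≫ eqToIso (congrArg (fun r => (H.capsule r).obj u) (ι.apply_symm_apply s))
  have hαT : ∀ z, αT (ι z) = α z := fun z =>
    DStrip.isoCast_eq (fun r => H.capsule (ι r)) _ α (ι.symm_apply_apply z)
  -- uniqueness of the four kinds of `ζ`, at a general index
  have hE : ∀ (s : H.T) (u : K.V) (ζ : K.LabCuspPM u ((H.capsule s).obj u) ≃ K.GLab H.glob),
      H.ellBridge.ZetaSpec s u ζ → ζ = DThetaEllBridge.zetaCandidate u (αT s u) γ (ι.symm s) := by
    intro s u ζ hζ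
    obtain ⟨z, rfl⟩ := ι.surjective s
    rw [hαT, Equiv.symm_apply_apply]
    exact H.ellBridge.zeta_eq_zetaCandidate (ι := ι) (α := α) (β := γ) hEll z u hζ
  have hP : ∀ (s : H.T) (u : K.V)
      (ζ : K.LabCuspPM u ((H.capsule s).obj u) ≃ K.LabCuspPM u (H.codomain.obj u)),
      H.pmBridge.ZetaSpec s u ζ → ζ = (K.labMap u (αT s u).symm).trans (K.labMap u (β u)) := by
    intro s u ζ hζ
    obtain ⟨z, rfl⟩ := ι.surjective s
    rw [hαT]
    exact H.pmBridge.zeta_eq (ι := ι) (α := α) (β := β) hPM z u hζ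
  rw [hP _ _ _ hPv0, hP _ _ _ hPw0, hP _ _ _ hPvt, hP _ _ _ hPwt, hE _ _ _ hEv0, hE _ _ _ hEw0,
    hE _ _ _ hEvt, hE _ _ _ hEwt]
  ext x
  simp [DThetaEllBridge.zetaCandidate, labMap_symm]

end DThetaPMEllHT

end PMBaseKit

end Literature.IUT.HodgeTheaters
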